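import Summits.ABC.IUTFork.Conditional.Layer6OfSa
import Summits.ABC.IUTFork.Conditional.Layer6OfSaWitness
import Summits.ABC.IUTFork.Conditional.Layer6OfSb
import HarnessLib

/-!
# L6 layer certificate — TOP: `Layer6Residual` / `layer6Cone_of` (director-abc (C2); L6-lead spec `plan/L6/CERT-L6.md` v0, §F v1.19n)

COUNT LINE (L6, both parts; grammar §F v1.19s «N = d_nodes + d_idx + r + d_data + f»): **L6 cone 188 = A [IUTchII] 119 + B [IUTchIII §1–3] 69 =
Discharged 152 nodes (A 91 [d_nodes 91 + d_idx 0] + B 61 [d_nodes 61 NODES-discharged + d_idx 0 index-discharged]) + r 1 (Residual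
conjuncts, lead-uncertified print coverage, kernel-inhabited via index `_part` witnesses: A 1 + B 0) + d_data 32 (constructed / definition / output-signature data, listed in the parts:
A 24 + B 8) + f 3 (flagged, listed: A 3 + B 0) + not-indexed 0 (A 0 + B 0)**; S consumed at L6: NO (S = `PilotKummerIndRelated` enters at the Cor. 3.12 node, c312's layer); FACT-LIST
facts as FREE hypotheses of the certificate: none — the named inputs bound INSIDE the conjoined theorem statements (instance forms, by
F-id) are censused in the K-L6 `L6-SLICE-INPUT-CENSUS-v3.md` (abc-iut-w5-d012; v3.3 c28597c1bbdbc93f, successor of abc-iut-w5-d109 g4's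
d889dbec7c7c1df3): 71 F-ids = schema-instance 44 · predicate/vocabulary 25 · proved 2 · conditional 0 · model-witness 0 · fact-open 0 (undecided-input
set ∅ since the F-2633 ∀-refutation p479412), plus hypothesis bundles (e.g. `GlobalFrobenioidModels.ModelHyps`, `ThetaSetting.Sec2Hyps`) — inputs
named, not endorsed. Numbers = the parts' COUNT LINEs AS FOUND IN THE TREE when this top was generated (A: Layer6OfSaFolds.lean (live count line, A frozen since v3.4ah); B: Layer6OfSb.lean; regenerated by `gen_top.py`);
the parts are re-filed whole per NODES version (L6-lead §F v1.19w) and their own COUNT LINEs are AUTHORITATIVE if newer than this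
file's. Placements CERT-L6-MAP v18 (abc-iut-w5-d012 g5; index inputs regenerated 2026-08-26T12:58Z; v2–v17 abc-iut-L6-t8). TOP maintainer abc-iut-w5-d012 g5 since 12:50Z (CERT-L6-WRITER; v5–v8 abc-iut-L6-t8 g6, v8–v9 abc-iut-w5-d012 g4 fallback; author of record v0–v4 abc-iut-L6-d4 g4).

WHAT THIS FILE IS. abc-iut cell, row CERT-L6-B+top (abc-iut-L6-d4 gen 4; maintained by abc-iut-L6-t8 gen 6). It imports the two parts
(`Conditional/Layer6OfSa.lean`, abc-iut-w5-d012 g4; `Conditional/Layer6OfSb.lean`, abc-iut-L6-d4 g4) and offers the apex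
`Conditional/AbcOfS.lean` (abc-iut-plan / C-cert) ONE binder for layer L6: `(h6 : Layer6Residual)`; `layer6Cone_of h6` then yields both
slices of the L6 cone (`Layer6ConeA ∧ Layer6ConeB`), the discharged halves being kernel theorems cited BY NAME. Since TOP v6 the binder is
OPTIONAL: `layer6Residual_inhabited` / `layer6Cone_holds` (below) give both slices outright from the parts' inhabitation theorems
(kernel-inhabited ≠ lead-discharged; r stays the print-coverage count). Every W6 discharge moves
one conjunct from a part's Residual to its Discharged (that part re-filed whole, this top untouched unless a universe arity changes).
Universe levels: the index's names, shared — `Layer6ResidualA.{u₁, u₂, u₃, u₄, u₅, u₆, u₇, u₈}`, `Layer6ResidualB.{u₁, u₂, u₃}`.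
HONEST FRAMING: proves nothing new, asserts nothing about [IUTchIII] Cor. 3.12; typed ≠ proved; indexed ≠ endorsed; no side taken;
nothing here says abc is proved or refuted. [claim: Mochizuki2012, status: disputed] (node texts). Version: TOP v14 @ NODES v3.4cd (docstring COUNT refresh only; decls unchanged since v6; A numbers from Layer6OfSaFolds.lean p489589 — IUTchII:Prop2.2(ii) r → d_nodes on w5-d169 g9 p488875 (lead gen 7 fold 10; second count move after Prop3.1(i) at v3.4cb / Folds p488574 / TOP v13 p488782), A 91/0/1 — r 1 = the value-held Prop1.3(iii), L6 has no landed row left; B from Layer6OfSb.lean v16 p439421; K-L6 census of record v3.3 c28597c1bbdbc93f; CERT-L6-WRITER abc-iut-w5-d012 gen 7).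
-/

namespace Summit.ABC.IUTFork.Conditional

/-- **L6 residual** = the C-scoreboard entries of layer L6: `Layer6ResidualA` ([IUTchII]) ∧ `Layer6ResidualB` ([IUTchIII] §1–3);
residual NODE counts per the parts' COUNT LINEs: A 1 / B 0 (a part may keep already-flipped rows inside a frozen residual conjunction and
witness them in an appended fold theorem — see its docstring). The ONE binder the apex takes for L6. [claim: Mochizuki2012, status: disputed] -/
def Layer6Residual.{u₁, u₂, u₃, u₄, u₅, u₆, u₇, u₈} : Prop :=
  Layer6ResidualA.{u₁, u₂, u₃, u₄, u₅, u₆, u₇, u₈} ∧ Layer6ResidualB.{u₁, u₂, u₃}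

/-- **L6 discharged** = `Layer6DischargedA` ∧ `Layer6DischargedB` (A 91 + B 61 nodes; L6 scoreboard = the NODES-discharged share), a kernel
theorem by the parts' witnesses
BY NAME. [claim: Mochizuki2012, status: disputed] -/
def Layer6Discharged.{u₁, u₂, u₃, u₄, u₅, u₆, u₇, u₈} : Prop :=
  Layer6DischargedA.{u₁, u₂, u₃, u₄, u₅, u₆, u₇, u₈} ∧ Layer6DischargedB.{u₁, u₂, u₃, u₄, u₅, u₆}

/-- `Layer6Discharged` holds (both halves are proved in the parts; nothing new here). [claim: Mochizuki2012, status: disputed] -/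
theorem layer6Discharged_holds.{u₁, u₂, u₃, u₄, u₅, u₆, u₇, u₈} : Layer6Discharged.{u₁, u₂, u₃, u₄, u₅, u₆, u₇, u₈} :=
  ⟨layer6DischargedA_holds, layer6DischargedB_holds⟩

/-- **The whole L6 slice of the Cor. 3.12 cone from its residual alone**: `Layer6Residual → Layer6ConeA ∧ Layer6ConeB`.
[claim: Mochizuki2012, status: disputed] -/
theorem layer6Cone_of.{u₁, u₂, u₃, u₄, u₅, u₆, u₇, u₈} (h : Layer6Residual.{u₁, u₂, u₃, u₄, u₅, u₆, u₇, u₈}) :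
    Layer6ConeA.{u₁, u₂, u₃, u₄, u₅, u₆, u₇, u₈} ∧ Layer6ConeB.{u₁, u₂, u₃, u₄, u₅, u₆} :=
  ⟨layer6ConeA_of h.1, layer6ConeB_of h.2⟩

/-- **The L6 binder is dischargeable BY NAME**: `Layer6Residual` is kernel-inhabited — part A by `layer6ResidualA_inhabited`
(Layer6OfSaWitness p429165, stable: part A is frozen) and part B by `layer6ResidualB_inhabited` (regenerated inside Layer6OfSb.lean
with its residual at every re-file). Kernel-inhabited ≠ lead-discharged: r in the COUNT LINE stays the NODES print-coverage count.
[claim: Mochizuki2012, status: disputed] -/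
theorem layer6Residual_inhabited.{u₁, u₂, u₃, u₄, u₅, u₆, u₇, u₈} : Layer6Residual.{u₁, u₂, u₃, u₄, u₅, u₆, u₇, u₈} :=
  ⟨layer6ResidualA_inhabited, layer6ResidualB_inhabited⟩

/-- Hence the whole L6 slice of the Cor. 3.12 cone holds in the kernel, both parts, no binder (for the apex `AbcOfS`, by name).
[claim: Mochizuki2012, status: disputed] -/
theorem layer6Cone_holds.{u₁, u₂, u₃, u₄, u₅, u₆, u₇, u₈} : Layer6ConeA.{u₁, u₂, u₃, u₄, u₅, u₆, u₇, u₈} ∧ Layer6ConeB.{u₁, u₂, u₃, u₄, u₅, u₆} :=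
  layer6Cone_of layer6Residual_inhabited

end Summit.ABC.IUTFork.Conditional
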